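import Literature.Probability.RandomPlanarGeometry.SLETransienceKappaEight
import Literature.Probability.RandomPlanarGeometry.SLEGridBounds
import Literature.Probability.RandomPlanarGeometry.LoewnerTipContinuity
import Literature.Analysis.Complex.HolderBoundaryArea
import HarnessLib

/-!
# The boundary of the SLE₈ hull is Lebesgue-null (Rohde–Schramm, Cor. 5.3 at `κ = 8`) from Cor. 3.5

Trunk T-STOCH. Tenure file of the named fact
`Literature.Probability.RandomPlanarGeometry.RohdeSchramm2005_thm71_eight` (Rohde–Schramm (2005),
Thm. 7.1 at `κ = 8`). By `RohdeSchramm2005_thm71_eight_of_smallbd` (`SLETransienceKappaEight`)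
that fact follows from Rohde–Schramm's **Corollary 5.3** at `κ = 8`: for every `t`, almost
surely `area ∂Kₜ = 0`. Here Cor. 5.3 at `κ = 8` is **proved from the derivative estimate
Cor. 3.5** (the named fact `RohdeSchramm2005_cor35`, through which the whole trace theory of the
tree is routed), following the printed route Cor. 3.5 ⇒ Thm. 5.2 (Hölder continuity, p. 901:
Borel–Cantelli on the dyadic grid `z_{j,n} = (j + i)2⁻ⁿ` and Koebe distortion) ⇒ Cor. 5.3, with
the Jones–Makarov input replaced by the elementary porosity/density lemma of
`Literature/Analysis/Complex/HolderBoundaryArea.lean` (zero area instead of dimension `< 2`):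

* `RohdeSchramm2005_cor35.ae_exists_grid_plane` — (5.4) at `κ = 8`: for a Brownian motion `B`
  with continuous paths, `t ≤ 1` and `R ∈ ℕ`, almost surely
  `|f̂ₜ'(z_{j,n})| ≤ c(ω) (2ⁿ)^{19/20}` for all `n` and `|j| ≤ R 2ⁿ` (Cor. 3.5 with `b = 3/8`,
  `λ = 15/8`, `a - λ = -3/16 < 0`, `δ = (2ⁿ)^{-1/20}`: the bad events at level `n` have total
  probability `≤ K_R (2ⁿ)^{-1/32}`; Borel–Cantelli).
* `norm_deriv_le_rpow_of_grid` (deterministic, Koebe distortion `norm_deriv_le_pow_mul`): such a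
  grid bound gives `|f'(x + iy)| ≤ 12⁴ c y^{-19/20}` on `[-(R-1), R-1] × (0, 1]`;
  `norm_sub_le_rpow_of_deriv` (Koebe growth along the dyadic heights): hence
  `|f(x + iσ) - f(x + iσ2⁻ᴺ)| ≤ K σ^{1/20}`, the vertical Hölder approach.
* `Loewner.IsGeneratedByCurve.exists_bdryInv_eq_of_mem_frontier_hull` (deterministic): a point of
  `frontier Kₜ` off the real line is a boundary value `f̄ₜ(v)`, `v ∈ ℝ`.
* `ae_volume_frontier_hull_eq_zero_of_cor35` — for any Brownian motion `B` with continuous paths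
  whose chain `√8 B` is a.s. generated by a curve and `t ≤ 1`: a.s. `volume (frontier Kₜ) = 0`
  (`Literature.Analysis.Complex.volume_eq_zero_of_norm_sub_le_rpow`).
* `ae_volume_frontier_sleHull_eight_eq_zero_of_cor35` — on the canonical space, for SLE₈
  generated by a curve (`HasSLETrace 8`), **for every `t`** (Brownian scaling
  `IsBrownianReal.smul` to a time `≤ 1`, `Loewner.hull_scale_holds`).
* `RohdeSchramm2005_thm71_eight_of_cor35` — **`RohdeSchramm2005_thm71_eight` from
  `RohdeSchramm2005_cor35` alone.**

## References

* S. Rohde, O. Schramm, *Basic properties of SLE*, Ann. of Math. 161 (2005): Cor. 3.5, Thm. 5.2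
  and its proof (eq. (5.4)), Cor. 5.3, Lemma 7.3, Thm. 7.1 and Update (p. 911).
* G. F. Lawler, *Conformally Invariant Processes in the Plane*, AMS (2005), Lemma 4.33, §7.4.
-/

noncomputable section

open Set Filter Topology Metric Complex MeasureTheory ProbabilityTheory
open UpperHalfPlane (upperHalfPlaneSet isOpen_upperHalfPlaneSet)
open scoped NNReal ENNReal Pointwise

namespace Literature.Probability.RandomPlanarGeometry

open Literature.Analysis.Complex Literature.Analysis.Complex.AreaThm

/-! ### Deterministic: from a grid bound on `f'` to the vertical Hölder approach -/

section Deterministic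

variable {f : ℂ → ℂ}

/-- **From the dyadic grid to all points** (Koebe distortion). If `f` is holomorphic and
injective on `ℍ` and `|f'(z_{j,n})| ≤ c (2ⁿ)ᵉ` at the grid points `z_{j,n} = (j + i) 2⁻ⁿ`,
`|j| ≤ R 2ⁿ` (`0 < e < 1`), then `|f'(x + iy)| ≤ 12⁴ c y⁻ᵉ` for `|x| + 1 ≤ R`, `0 < y ≤ 1`:
with `2ⁿ ≤ 1/y < 2ⁿ⁺¹` and `j` the nearest integer to `x 2ⁿ`, the points `x + iy` and `z_{j,n}`
are at height `≥ 2⁻ⁿ⁻¹` and distance `≤ 2⁻ⁿ`, four half-steps of `norm_deriv_le_pow_mul`.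
Rohde–Schramm (2005), proof of Thm. 5.2 ("From the Koebe distortion Theorem and (5.4) we obtain
`|f̂ₜ'(z)| ≤ O(1) C(ω, t) y^{h-1}`", p. 901). [cite: RohdeSchramm2005, Thm 5.2 (proof)] -/
theorem norm_deriv_le_rpow_of_grid (hf : DifferentiableOn ℂ f upperHalfPlaneSet)
    (hinj : InjOn f upperHalfPlaneSet) {c e : ℝ} (he0 : 0 < e) {R : ℕ}
    (hgrid : ∀ (n : ℕ) (j : ℤ), |(j : ℝ)| ≤ R * 2 ^ n →
      ‖deriv f (↑((j : ℝ) * ((2 : ℝ) ^ n)⁻¹) + I * ↑(((2 : ℝ) ^ n)⁻¹))‖ ≤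
        c * ((2 : ℝ) ^ n) ^ e)
    {x y : ℝ} (hx : |x| + 1 ≤ R) (hy0 : 0 < y) (hy1 : y ≤ 1) :
    ‖deriv f (x + y * I)‖ ≤ 12 ^ 4 * c * y ^ (-e) := by
  -- the dyadic level `n` with `2ⁿ ≤ 1/y < 2ⁿ⁺¹`
  obtain ⟨n, hn1, hn2⟩ := exists_nat_pow_near (one_le_inv_iff₀.2 ⟨hy0, hy1⟩) one_lt_two
  set N : ℝ := (2 : ℝ) ^ n with hN_def
  have hN0 : 0 < N := by positivity
  have hyN : y ≤ N⁻¹ := by rw [le_inv_comm₀ hy0 hN0]; exact hn1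
  have hNy : N⁻¹ < 2 * y := by
    rw [pow_succ] at hn2
    rw [inv_lt_iff_one_lt_mul₀ hN0]
    have := (inv_lt_iff_one_lt_mul₀ hy0).1 (show y⁻¹ < N * 2 from hn2)
    nlinarith
  -- the nearest grid column `j`
  set j : ℤ := round (x * N) with hj_def
  have hjx : |x * N - j| ≤ 1 / 2 := abs_sub_round _
  have hjR : |(j : ℝ)| ≤ R * 2 ^ n := by
    have h1 : |(j : ℝ)| ≤ |x * N| + 1 / 2 := by
      have := abs_sub_abs_le_abs_sub (j : ℝ) (x * N)
      rw [abs_sub_comm] at this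
      linarith
    have hR : (1 : ℝ) ≤ R := le_trans (by linarith [abs_nonneg x]) hx
    have hN1 : (1 : ℝ) ≤ N := one_le_pow₀ one_le_two
    rw [abs_mul, abs_of_pos hN0] at h1
    have : |x| * N + 1 / 2 ≤ R * N := by nlinarith [abs_nonneg x]
    exact h1.trans this
  have hgj := hgrid n j hjR
  -- geometry of the two points
  set z₀ : ℂ := ↑((j : ℝ) * N⁻¹) + I * ↑(N⁻¹) with hz₀_def
  set z : ℂ := (x : ℂ) + (y : ℂ) * I with hz_def
  have hz₀im : z₀.im = N⁻¹ := by simp [hz₀_def]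
  have hzim : z.im = y := by simp [hz_def]
  have hy₀ : 0 < N⁻¹ / 2 := by positivity
  have hdist : ‖z - z₀‖ ≤ (4 : ℕ) * (N⁻¹ / 2) / 2 := by
    have hre : |(z - z₀).re| ≤ N⁻¹ / 2 := by
      have : (z - z₀).re = (x * N - j) * N⁻¹ := by
        simp [hz_def, hz₀_def]; field_simp
      rw [this, abs_mul, abs_of_pos (inv_pos.2 hN0)]
      calc |x * N - ↑j| * N⁻¹ ≤ 1 / 2 * N⁻¹ := by gcongr
        _ = N⁻¹ / 2 := by ring
    have him : |(z - z₀).im| ≤ N⁻¹ / 2 := by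
      have : (z - z₀).im = y - N⁻¹ := by simp [hz_def, hz₀_def]
      rw [this, abs_sub_comm, abs_of_nonneg (by linarith)]
      linarith
    calc ‖z - z₀‖ ≤ |(z - z₀).re| + |(z - z₀).im| := Complex.norm_le_abs_re_add_abs_im _
      _ ≤ N⁻¹ / 2 + N⁻¹ / 2 := add_le_add hre him
      _ = (4 : ℕ) * (N⁻¹ / 2) / 2 := by push_cast; ring
  have hstep := norm_deriv_le_pow_mul hf hinj hy₀ 4 (z := z₀) (w := z)
    (by rw [hz₀im]; linarith) (by rw [hzim]; linarith) hdist
  -- `c ≥ 0` (from the grid bound at `z_{0,0} = i`) and `(2ⁿ)ᵉ ≤ y⁻ᵉ`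
  have hc0 : 0 ≤ c := by
    have h00 := hgrid 0 0 (by simp)
    simp only [pow_zero, Real.one_rpow, mul_one] at h00
    exact (norm_nonneg _).trans h00
  have hpow : N ^ e ≤ y ^ (-e) := by
    rw [Real.rpow_neg hy0.le, ← Real.inv_rpow hy0.le]
    exact Real.rpow_le_rpow hN0.le hn1 he0.le
  calc ‖deriv f z‖ ≤ 12 ^ 4 * ‖deriv f z₀‖ := hstep
    _ ≤ 12 ^ 4 * (c * N ^ e) := by gcongr
    _ ≤ 12 ^ 4 * (c * y ^ (-e)) := by gcongr
    _ = 12 ^ 4 * c * y ^ (-e) := by ring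

/-- **Vertical Hölder approach from the derivative bound** (Koebe growth along dyadic heights).
If `f` is holomorphic and injective on `ℍ` and `|f'(x + iy)| ≤ c' y⁻ᵉ` for `0 < y ≤ 1`
(`0 < e < 1`), then for `0 < σ ≤ 1` and every `N`,
`|f(x + iσ) - f(x + iσ2⁻ᴺ)| ≤ (2c'/(1 - 2^{e-1})) σ^{1-e}`: each dyadic step costs
`|f(x + iσ2⁻ᵏ⁻¹) - f(x + iσ2⁻ᵏ)| ≤ 2 (σ2⁻ᵏ) |f'(x + iσ2⁻ᵏ)| ≤ 2c' (σ2⁻ᵏ)^{1-e}`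
(`distortion_upperHalfPlane`), a geometric series. This is "integrating `|f'|` over the
hyperbolic geodesic" in Rohde–Schramm (2005), proof of Thm. 5.2 (p. 901).
[cite: RohdeSchramm2005, Thm 5.2 (proof)] -/
theorem norm_sub_le_rpow_of_deriv (hf : DifferentiableOn ℂ f upperHalfPlaneSet)
    (hinj : InjOn f upperHalfPlaneSet) {x c' e : ℝ} (he1 : e < 1)
    (hder : ∀ y : ℝ, 0 < y → y ≤ 1 → ‖deriv f (x + y * I)‖ ≤ c' * y ^ (-e))
    {σ : ℝ} (hσ0 : 0 < σ) (hσ1 : σ ≤ 1) (N : ℕ) :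
    ‖f (x + σ * I) - f (x + (σ * 2⁻¹ ^ N : ℝ) * I)‖ ≤
      2 * c' / (1 - (2 : ℝ) ^ (e - 1)) * σ ^ (1 - e) := by
  set ρ : ℝ := (2 : ℝ) ^ (e - 1) with hρ_def
  have hρ0 : 0 < ρ := Real.rpow_pos_of_pos two_pos _
  have hρ1 : ρ < 1 := Real.rpow_lt_one_of_one_lt_of_neg one_lt_two (by linarith)
  set z : ℝ → ℂ := fun τ ↦ (x : ℂ) + (τ : ℂ) * I with hz_def
  have hzim : ∀ τ, (z τ).im = τ := fun τ ↦ by simp [hz_def]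
  have hc' : 0 ≤ c' := by
    have := hder 1 one_pos le_rfl
    rw [Real.one_rpow, mul_one] at this
    exact (norm_nonneg _).trans this
  have hdy_pos : ∀ k : ℕ, 0 < σ * 2⁻¹ ^ k := fun k ↦ by positivity
  have hdy_le : ∀ k : ℕ, σ * 2⁻¹ ^ k ≤ 1 := fun k ↦
    (mul_le_of_le_one_right hσ0.le (pow_le_one₀ (by norm_num) (by norm_num))).trans hσ1
  have hrpow : ∀ k : ℕ, (σ * 2⁻¹ ^ k) ^ (1 - e) = σ ^ (1 - e) * ρ ^ k := by
    intro k
    rw [Real.mul_rpow hσ0.le (by positivity), ← Real.rpow_pow_comm (by norm_num), hρ_def,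
      show e - 1 = -(1 - e) by ring, Real.rpow_neg zero_le_two, Real.inv_rpow zero_le_two]
  -- one dyadic step
  have hstep : ∀ k : ℕ, ‖f (z (σ * 2⁻¹ ^ k)) - f (z (σ * 2⁻¹ ^ (k + 1)))‖ ≤
      2 * c' * σ ^ (1 - e) * ρ ^ k := by
    intro k
    set τ : ℝ := σ * 2⁻¹ ^ k with hτ
    have hτ0 : 0 < τ := hdy_pos k
    have hnext : σ * 2⁻¹ ^ (k + 1) = τ / 2 := by rw [hτ, pow_succ]; ring
    have hdist : ‖z (τ / 2) - z τ‖ ≤ (z τ).im / 2 := by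
      rw [hzim]
      have : z (τ / 2) - z τ = ((τ / 2 - τ : ℝ) : ℂ) * I := by
        simp only [hz_def]; push_cast; ring
      rw [this, norm_mul, Complex.norm_I, mul_one, Complex.norm_real, Real.norm_eq_abs,
        show τ / 2 - τ = -(τ / 2) by ring, abs_neg, abs_of_pos (by positivity)]
    obtain ⟨-, -, h3⟩ := distortion_upperHalfPlane hf hinj (by rw [hzim]; exact hτ0) hdist
    rw [hzim, norm_sub_rev] at h3
    have hd := hder τ hτ0 (hdy_le k)
    have hττ : τ * τ ^ (-e) = τ ^ (1 - e) := by
      rw [Real.rpow_neg hτ0.le, Real.rpow_sub hτ0, Real.rpow_one, div_eq_mul_inv]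
    calc ‖f (z (σ * 2⁻¹ ^ k)) - f (z (σ * 2⁻¹ ^ (k + 1)))‖ = ‖f (z τ) - f (z (τ / 2))‖ := by
          rw [hnext]
      _ ≤ 2 * τ * ‖deriv f (z τ)‖ := h3
      _ ≤ 2 * τ * (c' * τ ^ (-e)) := by gcongr
      _ = 2 * c' * (τ * τ ^ (-e)) := by ring
      _ = 2 * c' * σ ^ (1 - e) * ρ ^ k := by rw [hττ, hτ, hrpow k]; ring
  -- telescoping
  have htel : ∀ N : ℕ, ‖f (z σ) - f (z (σ * 2⁻¹ ^ N))‖ ≤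
      2 * c' * σ ^ (1 - e) * ∑ k ∈ Finset.range N, ρ ^ k := by
    intro N
    induction N with
    | zero => simp
    | succ N ih =>
      calc ‖f (z σ) - f (z (σ * 2⁻¹ ^ (N + 1)))‖
          ≤ ‖f (z σ) - f (z (σ * 2⁻¹ ^ N))‖ +
              ‖f (z (σ * 2⁻¹ ^ N)) - f (z (σ * 2⁻¹ ^ (N + 1)))‖ :=
            norm_sub_le_norm_sub_add_norm_sub _ _ _
        _ ≤ 2 * c' * σ ^ (1 - e) * ∑ k ∈ Finset.range N, ρ ^ k +
              2 * c' * σ ^ (1 - e) * ρ ^ N := add_le_add ih (hstep N)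
        _ = 2 * c' * σ ^ (1 - e) * ∑ k ∈ Finset.range (N + 1), ρ ^ k := by
            rw [Finset.sum_range_succ]; ring
  have hgeom : ∑ k ∈ Finset.range N, ρ ^ k ≤ (1 - ρ)⁻¹ := by
    rw [← tsum_geometric_of_lt_one hρ0.le hρ1]
    exact (summable_geometric_of_lt_one hρ0.le hρ1).sum_le_tsum _ fun k _ ↦ by positivity
  have hK : 0 ≤ 2 * c' * σ ^ (1 - e) := by positivity
  calc ‖f (x + σ * I) - f (x + (σ * 2⁻¹ ^ N : ℝ) * I)‖ = ‖f (z σ) - f (z (σ * 2⁻¹ ^ N))‖ := by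
        simp only [hz_def]
    _ ≤ 2 * c' * σ ^ (1 - e) * ∑ k ∈ Finset.range N, ρ ^ k := htel N
    _ ≤ 2 * c' * σ ^ (1 - e) * (1 - ρ)⁻¹ := by gcongr
    _ = 2 * c' / (1 - ρ) * σ ^ (1 - e) := by rw [div_eq_mul_inv]; ring

end Deterministic

/-! ### Deterministic: points of `frontier Kₜ` off `ℝ` are boundary values of `fₜ` -/

namespace Loewner

variable {W : ℝ≥0 → ℝ} {γ : ℝ≥0 → ℂ}

/-- **A point of `frontier Kₜ` in the open half-plane is a boundary value `f̄ₜ(v)`, `v ∈ ℝ`, and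
lies off `Hₜ`.** Such a point is in `Kₜ` (relatively closed in `ℍ`) and in `cl Hₜ` (it is not
interior to `Kₜ`); points `zₙ → z` of `Hₜ = fₜ(ℍ)` are `fₜ(uₙ)` with `(uₙ)` bounded
(`|f̄ₜ(u) - u| ≤ C`), and a cluster point `u*` has `f̄ₜ(u*) = z`, hence is real (on `ℍ`, `f̄ₜ = fₜ`
takes values in `Hₜ ∌ z`). [folklore] -/
theorem IsGeneratedByCurve.exists_bdryInv_eq_of_mem_frontier_hull (hγ : IsGeneratedByCurve W γ)
    (hW : Continuous W) (t : ℝ≥0) {z : ℂ} (hz : z ∈ frontier (hull W t)) (hzim : 0 < z.im) :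
    z ∉ domain W t ∧ ∃ v : ℝ, bdryInv W t v = z := by
  have hzH : z ∈ upperHalfPlaneSet := hzim
  -- `z ∈ Kₜ` and `z ∈ cl Hₜ`
  have hzK : z ∈ hull W t := by
    by_contra hK
    have hzD : z ∈ domain W t := ⟨hzH, hK⟩
    obtain ⟨w, hwD, hwK⟩ :=
      mem_closure_iff_nhds.1 hz.1 (domain W t) ((isOpen_domain hW t).mem_nhds hzD)
    exact hwD.2 hwK
  have hzdom : z ∉ domain W t := fun h ↦ h.2 hzK
  have hzcl : z ∈ closure (domain W t) := by
    by_contra hcl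
    refine hz.2 (mem_interior_iff_mem_nhds.2 ?_)
    have h1 : (closure (domain W t))ᶜ ∈ 𝓝 z := isClosed_closure.isOpen_compl.mem_nhds hcl
    have h2 : upperHalfPlaneSet ∈ 𝓝 z := isOpen_upperHalfPlaneSet.mem_nhds hzH
    filter_upwards [h1, h2] with w hw1 hw2
    by_contra hwK
    exact hw1 (subset_closure ⟨hw2, hwK⟩)
  refine ⟨hzdom, ?_⟩
  -- a sequence `zₙ → z` in `Hₜ` and the bounded preimages `uₙ = gₜ(zₙ)`
  obtain ⟨s, hs, hslim⟩ := mem_closure_iff_seq_limit.1 hzcl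
  set u : ℕ → ℂ := fun n ↦ map W t (s n) with hu_def
  have huH : ∀ n, u n ∈ upperHalfPlaneSet := fun n ↦ mapsTo_map hW t (hs n)
  have hfu : ∀ n, bdryInv W t (u n) = s n := fun n ↦ by
    rw [bdryInv_eq_of_mem hW t (huH n), hu_def, loewnerInv_map hW (hs n)]
  obtain ⟨C, hC⟩ := exists_norm_bdryInv_sub_self_le hW t
  obtain ⟨M, hM⟩ : ∃ M : ℝ, ∀ n, ‖s n‖ ≤ M := by
    obtain ⟨M, hM⟩ := (isBounded_iff_forall_norm_le.1 (Metric.isBounded_range_of_tendsto s hslim))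
    exact ⟨M, fun n ↦ hM _ (mem_range_self n)⟩
  have hubound : ∀ n, u n ∈ closedBall (0 : ℂ) (M + C) := by
    intro n
    rw [mem_closedBall, dist_zero_right]
    have h1 := hC (u n) (huH n)
    rw [hfu n] at h1
    calc ‖u n‖ = ‖s n - (s n - u n)‖ := by ring_nf
      _ ≤ ‖s n‖ + ‖s n - u n‖ := norm_sub_le _ _
      _ ≤ M + C := add_le_add (hM n) h1
  obtain ⟨ustar, -, φ, hφ, hlim⟩ := tendsto_subseq_of_bounded (isBounded_closedBall (x := (0 : ℂ))
    (r := M + C)) hubound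
  -- `f̄ₜ(u*) = z`
  have hcl : ustar ∈ {w : ℂ | 0 ≤ w.im} := by
    rw [← closure_setOf_lt_im 0]
    exact mem_closure_of_tendsto hlim (Eventually.of_forall fun n ↦ huH (φ n))
  have hFz : bdryInv W t ustar = z := by
    have hcont := (hγ.continuousOn_bdryInv hW t).continuousWithinAt hcl
    have h1 : Tendsto (fun n ↦ bdryInv W t (u (φ n))) atTop (𝓝 (bdryInv W t ustar)) :=
      hcont.tendsto.comp (tendsto_nhdsWithin_iff.2 ⟨hlim, Eventually.of_forall fun n ↦
        (show (0 : ℝ) < (u (φ n)).im from huH (φ n)).le⟩)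
    have h2 : Tendsto (fun n ↦ bdryInv W t (u (φ n))) atTop (𝓝 z) := by
      simp_rw [hfu]
      exact hslim.comp hφ.tendsto_atTop
    exact tendsto_nhds_unique h1 h2
  -- `u*` is real
  have him : ustar.im = 0 := by
    refine le_antisymm (not_lt.1 fun hpos ↦ ?_) hcl
    have hmem : bdryInv W t ustar ∈ domain W t := bdryInv_mem_domain hW t hpos
    rw [hFz] at hmem
    exact hzdom hmem
  refine ⟨ustar.re, ?_⟩
  rw [← hFz]
  congr 1
  exact Complex.ext (by simp) (by simp [him])

end Loewner

/-- The real line is Lebesgue-null in `ℂ`. [folklore] -/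
theorem volume_setOf_im_eq_zero : volume {z : ℂ | z.im = 0} = 0 := by
  have h : {z : ℂ | z.im = 0} = (LinearMap.ker Complex.imLm : Submodule ℝ ℂ) := by
    ext z; simp
  rw [h]
  refine Measure.addHaar_submodule volume _ fun htop ↦ ?_
  have : (I : ℂ) ∈ (LinearMap.ker Complex.imLm : Submodule ℝ ℂ) := by rw [htop]; trivial
  simp at this

/-! ### Probabilistic: (5.4) on the planar dyadic grid at `κ = 8`, from Cor. 3.5 -/

section Grid

variable {Ω : Type*} [MeasurableSpace Ω] {P : Measure Ω}

/-- Exponent bookkeeping for Cor. 3.5 at `κ = 8`, `b = 3/8`: `λ = 15/8`. [folklore] -/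
theorem expLam_eight : RohdeSchramm.expLam 8 (3 / 8) = 15 / 8 := by
  norm_num [RohdeSchramm.expLam]

/-- Exponent bookkeeping for Cor. 3.5 at `κ = 8`, `b = 3/8`: `a - λ = -3/16 < 0`. [folklore] -/
theorem expA_sub_expLam_eight : RohdeSchramm.expA 8 (3 / 8) - RohdeSchramm.expLam 8 (3 / 8) < 0 := by
  norm_num [RohdeSchramm.expA, RohdeSchramm.expLam]

/-- **The one-point bound on the planar grid** (Cor. 3.5 at `κ = 8`, `b = 3/8`, at the point
`z_{j,n} = (j + i)/N`, `N = 2ⁿ`, with `δ = N^{-1/20}`): for `t ≤ 1` and `|j| ≤ R N`,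
`P[|f̂ₜ'(z_{j,n})| ≥ N^{19/20}] ≤ C (1 + j²)^{3/8} N^{-57/32} ≤ C (1 + R²)^{3/8} N^{-33/32}`.
[cite: RohdeSchramm2005, Thm 5.2 (proof, (5.4))] -/
theorem RohdeSchramm2005_cor35.measure_grid_plane_le {C : ℝ}
    (hC : ∀ (B : ℝ≥0 → Ω → ℝ), IsBrownianReal B P → (∀ ω, Continuous (B · ω)) →
      ∀ (t : ℝ≥0), t ≤ 1 → ∀ (x y δ : ℝ), 0 < y → y ≤ 1 → 0 < δ → δ ≤ 1 →
        P {ω | δ / y ≤ ‖deriv (Loewner.fHat (fun s ↦ Real.sqrt (8 : ℝ≥0) * B s ω) t) (x + I * y)‖} ≤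
          ENNReal.ofReal (C * (1 + x ^ 2 / y ^ 2) ^ (3 / 8 : ℝ) *
            (y / δ) ^ RohdeSchramm.expLam (8 : ℝ≥0) (3 / 8) *
            RohdeSchramm.theta δ (RohdeSchramm.expA (8 : ℝ≥0) (3 / 8) -
              RohdeSchramm.expLam (8 : ℝ≥0) (3 / 8))))
    {B : ℝ≥0 → Ω → ℝ} (hB : IsBrownianReal B P) (hBc : ∀ ω, Continuous (B · ω))
    {t : ℝ≥0} (ht : t ≤ 1) (R n : ℕ) {j : ℤ} (hj : |(j : ℝ)| ≤ R * 2 ^ n) :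
    P {ω | ((2 : ℝ) ^ n) ^ (19 / 20 : ℝ) ≤
        ‖deriv (Loewner.fHat (fun s ↦ Real.sqrt (8 : ℝ≥0) * B s ω) t)
          (↑((j : ℝ) * ((2 : ℝ) ^ n)⁻¹) + I * ↑(((2 : ℝ) ^ n)⁻¹))‖} ≤
      ENNReal.ofReal (max C 0 * (1 + (R : ℝ) ^ 2) ^ (3 / 8 : ℝ) * ((2 : ℝ) ^ n) ^ (-(33 / 32) : ℝ)) := by
  set N : ℝ := (2 : ℝ) ^ n with hN_def
  have hN0 : 0 < N := by positivity
  have hN1 : 1 ≤ N := one_le_pow₀ one_le_two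
  set δ : ℝ := N ^ (-(1 / 20) : ℝ) with hδ_def
  have hδ0 : 0 < δ := Real.rpow_pos_of_pos hN0 _
  have hδ1 : δ ≤ 1 := Real.rpow_le_one_of_one_le_of_nonpos hN1 (by norm_num)
  have hy0 : 0 < N⁻¹ := inv_pos.2 hN0
  have hy1 : N⁻¹ ≤ 1 := inv_le_one_of_one_le₀ hN1
  -- the threshold `δ / y = N^{19/20}`
  have hthr : δ / N⁻¹ = N ^ (19 / 20 : ℝ) := by
    rw [hδ_def, div_inv_eq_mul, ← Real.rpow_add_one hN0.ne']
    norm_num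
  have h := hC B hB hBc t ht ((j : ℝ) * N⁻¹) N⁻¹ δ hy0 hy1 hδ0 hδ1
  rw [hthr] at h
  refine h.trans (ENNReal.ofReal_le_ofReal ?_)
  -- bookkeeping of the right-hand side
  have hκ : ((8 : ℝ≥0) : ℝ) = 8 := by norm_num
  rw [hκ, RohdeSchramm.theta_of_neg _ expA_sub_expLam_eight, mul_one, expLam_eight]
  have hx : 1 + ((j : ℝ) * N⁻¹) ^ 2 / N⁻¹ ^ 2 = 1 + (j : ℝ) ^ 2 := by
    field_simp
  have hratio : N⁻¹ / δ = N ^ (-(19 / 20) : ℝ) := by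
    rw [hδ_def, ← Real.rpow_neg_one, ← Real.rpow_sub hN0]
    norm_num
  have hpow1 : (N ^ (-(19 / 20) : ℝ)) ^ (15 / 8 : ℝ) = N ^ (-(57 / 32) : ℝ) := by
    rw [← Real.rpow_mul hN0.le]; norm_num
  rw [hx, hratio, hpow1]
  -- `(1 + j²)^{3/8} ≤ (1 + R²)^{3/8} N^{3/4}`
  have hj2 : (j : ℝ) ^ 2 ≤ (R : ℝ) ^ 2 * N ^ 2 := by
    have := sq_abs (j : ℝ)
    rw [← this]
    have h0 : 0 ≤ |(j : ℝ)| := abs_nonneg _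
    calc |(j : ℝ)| ^ 2 ≤ ((R : ℝ) * N) ^ 2 := by gcongr
      _ = (R : ℝ) ^ 2 * N ^ 2 := by ring
  have hbase : 1 + (j : ℝ) ^ 2 ≤ (1 + (R : ℝ) ^ 2) * N ^ 2 := by
    have : (1 : ℝ) ≤ N ^ 2 := one_le_pow₀ hN1
    nlinarith
  have hb : (1 + (j : ℝ) ^ 2) ^ (3 / 8 : ℝ) ≤ (1 + (R : ℝ) ^ 2) ^ (3 / 8 : ℝ) * N ^ (3 / 4 : ℝ) := by
    calc (1 + (j : ℝ) ^ 2) ^ (3 / 8 : ℝ) ≤ ((1 + (R : ℝ) ^ 2) * N ^ 2) ^ (3 / 8 : ℝ) :=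
          Real.rpow_le_rpow (by positivity) hbase (by norm_num)
      _ = (1 + (R : ℝ) ^ 2) ^ (3 / 8 : ℝ) * (N ^ 2) ^ (3 / 8 : ℝ) :=
          Real.mul_rpow (by positivity) (by positivity)
      _ = (1 + (R : ℝ) ^ 2) ^ (3 / 8 : ℝ) * N ^ (3 / 4 : ℝ) := by
          rw [← Real.rpow_natCast_mul hN0.le]; norm_num
  have hprod : N ^ (3 / 4 : ℝ) * N ^ (-(57 / 32) : ℝ) = N ^ (-(33 / 32) : ℝ) := by
    rw [← Real.rpow_add hN0]; norm_num
  have hC0 : 0 ≤ max C 0 := le_max_right _ _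
  calc C * (1 + (j : ℝ) ^ 2) ^ (3 / 8 : ℝ) * N ^ (-(57 / 32) : ℝ)
      ≤ max C 0 * (1 + (j : ℝ) ^ 2) ^ (3 / 8 : ℝ) * N ^ (-(57 / 32) : ℝ) := by
        gcongr
        exact le_max_left _ _
    _ ≤ max C 0 * ((1 + (R : ℝ) ^ 2) ^ (3 / 8 : ℝ) * N ^ (3 / 4 : ℝ)) * N ^ (-(57 / 32) : ℝ) := by
        gcongr
    _ = max C 0 * (1 + (R : ℝ) ^ 2) ^ (3 / 8 : ℝ) * (N ^ (3 / 4 : ℝ) * N ^ (-(57 / 32) : ℝ)) := by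
        ring
    _ = max C 0 * (1 + (R : ℝ) ^ 2) ^ (3 / 8 : ℝ) * N ^ (-(33 / 32) : ℝ) := by rw [hprod]

/-- `(2ⁿ)^{-1/32} = (2^{-1/32})ⁿ` and the count `2ⁿ · (2ⁿ)^{-33/32} = (2ⁿ)^{-1/32}`. [folklore] -/
theorem two_pow_rpow_bookkeeping (n : ℕ) :
    (2 : ℝ) ^ n * ((2 : ℝ) ^ n) ^ (-(33 / 32) : ℝ) = ((2 : ℝ) ^ (-(1 / 32) : ℝ)) ^ n := by
  have h0 : (0 : ℝ) < (2 : ℝ) ^ n := by positivity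
  rw [Real.rpow_pow_comm zero_le_two,
    show (2 : ℝ) ^ n * ((2 : ℝ) ^ n) ^ (-(33 / 32) : ℝ) =
      ((2 : ℝ) ^ n) ^ (1 : ℝ) * ((2 : ℝ) ^ n) ^ (-(33 / 32) : ℝ) by rw [Real.rpow_one],
    ← Real.rpow_add h0]
  norm_num

/-- **(5.4) on the planar dyadic grid at `κ = 8`, almost surely** (Borel–Cantelli on
`RohdeSchramm2005_cor35.measure_grid_plane_le`): for a Brownian motion `B` with continuous paths,
`t ≤ 1` and `R ∈ ℕ`, almost surely there is `c` with `|f̂ₜ'((j + i) 2⁻ⁿ)| ≤ c (2ⁿ)^{19/20}` for all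
`n ∈ ℕ` and all integers `|j| ≤ R 2ⁿ` (the `3R2ⁿ` bad events at level `n` have total probability
`≤ K_R (2ⁿ)^{-1/32}`, a summable series; finitely many exceptional levels are absorbed into `c`).
Rohde–Schramm (2005), proof of Thm. 5.2, eq. (5.4) with `h = 1/20 < 1/15` at `κ = 8`.
[cite: RohdeSchramm2005, Thm 5.2 (proof, (5.4))] -/
theorem RohdeSchramm2005_cor35.ae_exists_grid_plane (h : RohdeSchramm2005_cor35 P)
    {B : ℝ≥0 → Ω → ℝ} (hB : IsBrownianReal B P) (hBc : ∀ ω, Continuous (B · ω))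
    {t : ℝ≥0} (ht : t ≤ 1) (R : ℕ) :
    ∀ᵐ ω ∂P, ∃ c : ℝ, ∀ (n : ℕ) (j : ℤ), |(j : ℝ)| ≤ R * 2 ^ n →
      ‖deriv (Loewner.fHat (fun s ↦ Real.sqrt (8 : ℝ≥0) * B s ω) t)
        (↑((j : ℝ) * ((2 : ℝ) ^ n)⁻¹) + I * ↑(((2 : ℝ) ^ n)⁻¹))‖ ≤
        c * ((2 : ℝ) ^ n) ^ (19 / 20 : ℝ) := by
  obtain ⟨C, hC⟩ := h 8 (by norm_num) (3 / 8) (by norm_num) (by norm_num)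
  -- the grid values and the bad events
  set D : Ω → ℕ → ℤ → ℝ := fun ω n j ↦
    ‖deriv (Loewner.fHat (fun s ↦ Real.sqrt (8 : ℝ≥0) * B s ω) t)
      (↑((j : ℝ) * ((2 : ℝ) ^ n)⁻¹) + I * ↑(((2 : ℝ) ^ n)⁻¹))‖ with hD
  set J : ℕ → Finset ℤ := fun n ↦ Finset.Icc (-((R * 2 ^ n : ℕ) : ℤ)) ((R * 2 ^ n : ℕ) : ℤ) with hJ
  have hJmem : ∀ (n : ℕ) (j : ℤ), j ∈ J n ↔ |(j : ℝ)| ≤ R * 2 ^ n := by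
    intro n j
    rw [hJ, Finset.mem_Icc, ← Int.cast_abs, show (R : ℝ) * 2 ^ n = ((R * 2 ^ n : ℕ) : ℤ) by
      push_cast; ring, Int.cast_le, abs_le]
  have hJcard : ∀ n : ℕ, ((J n).card : ℝ) ≤ (2 * R + 1) * 2 ^ n := by
    intro n
    rw [hJ, Int.card_Icc, show ((R * 2 ^ n : ℕ) : ℤ) + 1 - -((R * 2 ^ n : ℕ) : ℤ) =
      ((2 * (R * 2 ^ n) + 1 : ℕ) : ℤ) by push_cast; ring, Int.toNat_natCast]
    have : (1 : ℝ) ≤ 2 ^ n := one_le_pow₀ one_le_two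
    push_cast
    nlinarith
  set A : ℕ → Set Ω := fun n ↦ ⋃ j ∈ J n, {ω | ((2 : ℝ) ^ n) ^ (19 / 20 : ℝ) ≤ D ω n j} with hA
  set K : ℝ := max C 0 * (1 + (R : ℝ) ^ 2) ^ (3 / 8 : ℝ) with hK
  have hK0 : 0 ≤ K := mul_nonneg (le_max_right _ _) (Real.rpow_nonneg (by positivity) _)
  set r : ℝ := (2 : ℝ) ^ (-(1 / 32) : ℝ) with hr
  have hr0 : 0 ≤ r := Real.rpow_nonneg zero_le_two _
  have hr1 : r < 1 := Real.rpow_lt_one_of_one_lt_of_neg one_lt_two (by norm_num)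
  have hbound : ∀ n, P (A n) ≤ ENNReal.ofReal ((2 * R + 1) * K * r ^ n) := by
    intro n
    have hN0 : (0 : ℝ) < 2 ^ n := by positivity
    calc P (A n) ≤ ∑ j ∈ J n, P {ω | ((2 : ℝ) ^ n) ^ (19 / 20 : ℝ) ≤ D ω n j} :=
          measure_biUnion_finset_le _ _
      _ ≤ ∑ _j ∈ J n, ENNReal.ofReal (K * ((2 : ℝ) ^ n) ^ (-(33 / 32) : ℝ)) :=
          Finset.sum_le_sum fun j hj ↦
            RohdeSchramm2005_cor35.measure_grid_plane_le hC hB hBc ht R n ((hJmem n j).1 hj)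
      _ = ENNReal.ofReal ((J n).card * (K * ((2 : ℝ) ^ n) ^ (-(33 / 32) : ℝ))) := by
          rw [Finset.sum_const, nsmul_eq_mul, ENNReal.ofReal_mul (Nat.cast_nonneg _),
            ENNReal.ofReal_natCast]
      _ ≤ ENNReal.ofReal ((2 * R + 1) * 2 ^ n * (K * ((2 : ℝ) ^ n) ^ (-(33 / 32) : ℝ))) := by
          apply ENNReal.ofReal_le_ofReal
          have : 0 ≤ K * ((2 : ℝ) ^ n) ^ (-(33 / 32) : ℝ) := mul_nonneg hK0 (Real.rpow_nonneg hN0.le _)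
          exact mul_le_mul_of_nonneg_right (hJcard n) this
      _ = ENNReal.ofReal ((2 * R + 1) * K * r ^ n) := by
          rw [hr, ← two_pow_rpow_bookkeeping n]; ring_nf
  have hsum : ∑' n, P (A n) ≠ ∞ := by
    refine ne_top_of_le_ne_top ?_ (ENNReal.tsum_le_tsum hbound)
    have hnn : ∀ n : ℕ, 0 ≤ (2 * R + 1) * K * r ^ n := fun n ↦ by positivity
    rw [← ENNReal.ofReal_tsum_of_nonneg hnn
      (((summable_geometric_of_lt_one hr0 hr1).mul_left ((2 * R + 1) * K)))]
    exact ENNReal.ofReal_ne_top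
  filter_upwards [ae_eventually_notMem hsum] with ω hω
  obtain ⟨n₀, hn₀⟩ := eventually_atTop.1 hω
  have hgood : ∀ n, n₀ ≤ n → ∀ j ∈ J n, D ω n j < ((2 : ℝ) ^ n) ^ (19 / 20 : ℝ) := by
    intro n hn j hj
    have := hn₀ n hn
    simp only [hA, mem_iUnion, mem_setOf_eq, not_exists, not_le, exists_prop, not_and] at this
    exact this j hj
  -- absorb the finitely many levels `n < n₀`
  have hD0 : ∀ n j, 0 ≤ D ω n j := fun n j ↦ norm_nonneg _
  obtain ⟨M, hM0, hMle⟩ : ∃ M : ℝ, 0 ≤ M ∧ ∀ n j, n < n₀ → j ∈ J n → D ω n j ≤ M := by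
    refine ⟨∑ n ∈ Finset.range n₀, ∑ j ∈ J n, D ω n j,
      Finset.sum_nonneg fun n _ ↦ Finset.sum_nonneg fun j _ ↦ hD0 n j, fun n j hn hj ↦ ?_⟩
    calc D ω n j ≤ ∑ j' ∈ J n, D ω n j' :=
          Finset.single_le_sum (f := fun j' ↦ D ω n j') (fun j' _ ↦ hD0 n j') hj
      _ ≤ ∑ n' ∈ Finset.range n₀, ∑ j' ∈ J n', D ω n' j' :=
          Finset.single_le_sum (f := fun n' ↦ ∑ j' ∈ J n', D ω n' j')
            (fun n' _ ↦ Finset.sum_nonneg fun j' _ ↦ hD0 n' j') (Finset.mem_range.2 hn)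
  have hpow : ∀ n : ℕ, 1 ≤ ((2 : ℝ) ^ n) ^ (19 / 20 : ℝ) := fun n ↦
    Real.one_le_rpow (one_le_pow₀ one_le_two) (by norm_num)
  refine ⟨max 1 M, fun n j hj ↦ ?_⟩
  have hjJ : j ∈ J n := (hJmem n j).2 hj
  show D ω n j ≤ max 1 M * ((2 : ℝ) ^ n) ^ (19 / 20 : ℝ)
  rcases lt_or_ge n n₀ with hn | hn
  · calc D ω n j ≤ M := hMle n j hn hjJ
      _ ≤ max 1 M * 1 := by rw [mul_one]; exact le_max_right _ _
      _ ≤ max 1 M * ((2 : ℝ) ^ n) ^ (19 / 20 : ℝ) :=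
          mul_le_mul_of_nonneg_left (hpow n) (le_trans zero_le_one (le_max_left _ _))
  · calc D ω n j ≤ ((2 : ℝ) ^ n) ^ (19 / 20 : ℝ) := (hgood n hn j hjJ).le
      _ = 1 * ((2 : ℝ) ^ n) ^ (19 / 20 : ℝ) := (one_mul _).symm
      _ ≤ max 1 M * ((2 : ℝ) ^ n) ^ (19 / 20 : ℝ) :=
          mul_le_mul_of_nonneg_right (le_max_left _ _) (Real.rpow_nonneg (by positivity) _)

end Grid

/-! ### Cor. 5.3 at `κ = 8`: the boundary of the hull is null -/

namespace Loewner

variable {W : ℝ≥0 → ℝ} {γ : ℝ≥0 → ℂ}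

/-- `f̂ₜ(ℍ) = Hₜ` (translation by `W t` preserves `ℍ`; `image_loewnerInv`). [folklore] -/
theorem image_fHat (hW : Continuous W) (t : ℝ≥0) : fHat W t '' upperHalfPlaneSet = domain W t := by
  rw [fHat_eq_comp, Set.image_comp]
  have : (fun z : ℂ ↦ (W t : ℂ) + z) '' upperHalfPlaneSet = upperHalfPlaneSet := by
    ext w
    constructor
    · rintro ⟨z, hz, rfl⟩
      show 0 < ((W t : ℂ) + z).im
      simpa using hz
    · intro hw
      refine ⟨w - W t, ?_, by ring⟩
      show 0 < (w - (W t : ℂ)).im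
      simpa using hw
  rw [this, image_loewnerInv hW t]

/-- **The vertical Hölder approach of `f̂ₜ` to its boundary values, from a grid bound** (chain
generated by a curve): if `|f̂ₜ'((j + i)2⁻ⁿ)| ≤ c (2ⁿ)^{19/20}` for `|j| ≤ R 2ⁿ`, then for
`|x| + 1 ≤ R` and `0 < σ ≤ 1`, `|f̂ₜ(x + iσ) - f̄ₜ(W_t + x)| ≤ K σ^{1/20}` with
`K = 2 · 12⁴ c/(1 - 2^{-1/20})` (`norm_deriv_le_rpow_of_grid`, `norm_sub_le_rpow_of_deriv`, and
`f̂ₜ(x + iσ2⁻ᴺ) → f̄ₜ(W_t + x)`, `IsGeneratedByCurve.tendsto_bdryInv`). Rohde–Schramm (2005),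
proof of Thm. 5.2 (p. 901). [cite: RohdeSchramm2005, Thm 5.2 (proof)] -/
theorem IsGeneratedByCurve.norm_fHat_sub_bdryInv_le (hγ : IsGeneratedByCurve W γ)
    (hW : Continuous W) (t : ℝ≥0) {c : ℝ} {R : ℕ}
    (hgrid : ∀ (n : ℕ) (j : ℤ), |(j : ℝ)| ≤ R * 2 ^ n →
      ‖deriv (fHat W t) (↑((j : ℝ) * ((2 : ℝ) ^ n)⁻¹) + I * ↑(((2 : ℝ) ^ n)⁻¹))‖ ≤
        c * ((2 : ℝ) ^ n) ^ (19 / 20 : ℝ))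
    {x : ℝ} (hx : |x| + 1 ≤ R) {σ : ℝ} (hσ0 : 0 < σ) (hσ1 : σ ≤ 1) :
    ‖fHat W t (x + σ * I) - bdryInv W t ((W t : ℂ) + x)‖ ≤
      2 * (12 ^ 4 * c) / (1 - (2 : ℝ) ^ ((19 / 20 : ℝ) - 1)) * σ ^ (1 - (19 / 20 : ℝ)) := by
  have hf := differentiableOn_fHat hW t
  have hinj := injOn_fHat hW t
  have hder : ∀ y : ℝ, 0 < y → y ≤ 1 →
      ‖deriv (fHat W t) (x + y * I)‖ ≤ 12 ^ 4 * c * y ^ (-(19 / 20 : ℝ)) := fun y hy0 hy1 ↦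
    norm_deriv_le_rpow_of_grid hf hinj (by norm_num) hgrid hx hy0 hy1
  have hN : ∀ N : ℕ, ‖fHat W t (x + σ * I) - fHat W t (x + (σ * 2⁻¹ ^ N : ℝ) * I)‖ ≤
      2 * (12 ^ 4 * c) / (1 - (2 : ℝ) ^ ((19 / 20 : ℝ) - 1)) * σ ^ (1 - (19 / 20 : ℝ)) :=
    fun N ↦ norm_sub_le_rpow_of_deriv hf hinj (by norm_num) hder hσ0 hσ1 N
  -- the limit `f̂ₜ(x + iσ2⁻ᴺ) → f̄ₜ(W_t + x)`
  set v : ℂ := (W t : ℂ) + x with hv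
  have hvim : 0 ≤ v.im := by simp [hv]
  have hseq : Tendsto (fun N : ℕ ↦ (W t : ℂ) + ((x : ℂ) + ((σ * 2⁻¹ ^ N : ℝ) : ℂ) * I))
      atTop (𝓝[upperHalfPlaneSet] v) := by
    refine tendsto_nhdsWithin_iff.2 ⟨?_, Eventually.of_forall fun N ↦ ?_⟩
    · have h0 : Tendsto (fun N : ℕ ↦ σ * 2⁻¹ ^ N) atTop (𝓝 0) := by
        simpa using (tendsto_pow_atTop_nhds_zero_of_lt_one (by norm_num : (0 : ℝ) ≤ 2⁻¹)
          (by norm_num : (2⁻¹ : ℝ) < 1)).const_mul σ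
      have h1 : Tendsto (fun N : ℕ ↦ ((σ * 2⁻¹ ^ N : ℝ) : ℂ) * I) atTop (𝓝 0) := by
        simpa using ((Complex.continuous_ofReal.tendsto 0).comp h0).mul_const I
      simpa [hv] using (h1.const_add (x : ℂ)).const_add (W t : ℂ)
    · show 0 < ((W t : ℂ) + ((x : ℂ) + ((σ * 2⁻¹ ^ N : ℝ) : ℂ) * I)).im
      simp only [add_im, ofReal_im, mul_im, ofReal_re, I_im, I_re, mul_one, mul_zero, zero_add,
        add_zero]
      positivity
  have hlim : Tendsto (fun N : ℕ ↦ fHat W t (x + (σ * 2⁻¹ ^ N : ℝ) * I)) atTop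
      (𝓝 (bdryInv W t v)) := by
    have h := (hγ.tendsto_bdryInv hW t hvim).comp hseq
    simpa only [Function.comp_def, fHat_apply] using h
  have htend : Tendsto (fun N : ℕ ↦ ‖fHat W t (x + σ * I) - fHat W t (x + (σ * 2⁻¹ ^ N : ℝ) * I)‖)
      atTop (𝓝 ‖fHat W t (x + σ * I) - bdryInv W t v‖) :=
    (tendsto_const_nhds.sub hlim).norm
  exact le_of_tendsto' htend hN

end Loewner

section Cor53

variable {Ω : Type*} [MeasurableSpace Ω] {P : Measure Ω}

/-- **Rohde–Schramm (2005), Cor. 5.3 at `κ = 8`, from Cor. 3.5 — general Brownian motion,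
`t ≤ 1`**: if `B` is a Brownian motion with continuous paths whose chain `√8 B` is almost surely
generated by a curve, then for `t ≤ 1` almost surely `volume (frontier Kₜ) = 0`. A point of
`frontier Kₜ` off the (null) real line is a boundary value `f̂ₜ(x) ∉ Hₜ`
(`IsGeneratedByCurve.exists_bdryInv_eq_of_mem_frontier_hull`), approached Hölder-fast along the
vertical line at `x` (`IsGeneratedByCurve.norm_fHat_sub_bdryInv_le`, from the a.s. grid bound
`RohdeSchramm2005_cor35.ae_exists_grid_plane`), so the porosity/density lemma
`Literature.Analysis.Complex.volume_eq_zero_of_norm_sub_le_rpow` applies. (The printed proof uses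
Thm. 5.2 and Jones–Makarov's dimension bound.) [cite: RohdeSchramm2005, Cor 5.3] -/
theorem ae_volume_frontier_hull_eq_zero_of_cor35 (h35 : RohdeSchramm2005_cor35 P)
    {B : ℝ≥0 → Ω → ℝ} (hB : IsBrownianReal B P) (hBc : ∀ ω, Continuous (B · ω))
    (hgen : ∀ᵐ ω ∂P, ∃ γ, Loewner.IsGeneratedByCurve (fun s ↦ Real.sqrt (8 : ℝ≥0) * B s ω) γ)
    {t : ℝ≥0} (ht : t ≤ 1) :
    ∀ᵐ ω ∂P, volume (frontier (Loewner.hull (fun s ↦ Real.sqrt (8 : ℝ≥0) * B s ω) t)) = 0 := by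
  have hgrid : ∀ᵐ ω ∂P, ∀ R : ℕ, ∃ c : ℝ, ∀ (n : ℕ) (j : ℤ), |(j : ℝ)| ≤ R * 2 ^ n →
      ‖deriv (Loewner.fHat (fun s ↦ Real.sqrt (8 : ℝ≥0) * B s ω) t)
        (↑((j : ℝ) * ((2 : ℝ) ^ n)⁻¹) + I * ↑(((2 : ℝ) ^ n)⁻¹))‖ ≤
        c * ((2 : ℝ) ^ n) ^ (19 / 20 : ℝ) :=
    ae_all_iff.2 fun R ↦ h35.ae_exists_grid_plane hB hBc ht R
  filter_upwards [hgrid, hgen] with ω hgridω hgenω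
  set W : ℝ≥0 → ℝ := fun s ↦ Real.sqrt (8 : ℝ≥0) * B s ω with hW_def
  have hW : Continuous W := continuous_const.mul (hBc ω)
  obtain ⟨γ, hγ⟩ := hgenω
  -- the part of the frontier off the real line
  have hS : volume {z ∈ frontier (Loewner.hull W t) | 0 < z.im} = 0 := by
    refine volume_eq_zero_of_norm_sub_le_rpow (Loewner.differentiableOn_fHat hW t)
      (Loewner.injOn_fHat hW t) (by rw [Loewner.image_fHat hW t]; exact Loewner.isOpen_domain hW t)
      fun w hw ↦ ?_
    obtain ⟨hwdom, v, hv⟩ := hγ.exists_bdryInv_eq_of_mem_frontier_hull hW t hw.1 hw.2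
    refine ⟨by rwa [Loewner.image_fHat hW t], v - W t,
      2 * (12 ^ 4 * (hgridω (⌈|v - W t|⌉₊ + 1)).choose) / (1 - (2 : ℝ) ^ ((19 / 20 : ℝ) - 1)),
      1 - (19 / 20 : ℝ), by norm_num, fun σ hσ0 hσ1 ↦ ?_⟩
    have hx : |v - W t| + 1 ≤ ((⌈|v - W t|⌉₊ + 1 : ℕ) : ℝ) := by
      push_cast
      linarith [Nat.le_ceil |v - W t|]
    have h := hγ.norm_fHat_sub_bdryInv_le hW t (hgridω (⌈|v - W t|⌉₊ + 1)).choose_spec hx hσ0 hσ1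
    have hvx : (W t : ℂ) + ((v - W t : ℝ) : ℂ) = (v : ℂ) := by push_cast; ring
    rwa [hvx, hv] at h
  -- the rest of the frontier is on the real line
  have hsub : frontier (Loewner.hull W t) ⊆
      {z ∈ frontier (Loewner.hull W t) | 0 < z.im} ∪ {z : ℂ | z.im = 0} := by
    intro z hz
    rcases lt_or_ge 0 z.im with him | him
    · exact Or.inl ⟨hz, him⟩
    · refine Or.inr (le_antisymm him ?_)
      have : z ∈ closure upperHalfPlaneSet := closure_mono (Loewner.hull_subset W t) hz.1
      rw [show closure upperHalfPlaneSet = {z : ℂ | 0 ≤ z.im} from closure_setOf_lt_im 0] at this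
      exact this
  exact measure_mono_null hsub (measure_union_null hS volume_setOf_im_eq_zero)

/-- **Rohde–Schramm (2005), Cor. 5.3 at `κ = 8`, from Cor. 3.5 — canonical space, every `t`**:
if SLE₈ is almost surely generated by a curve (`HasSLETrace 8`, [LSW] Thm. 4.7) and Cor. 3.5
holds on the canonical space, then for every `t` almost surely `volume (frontier Kₜ) = 0` for the
SLE₈ hull. For `c ≥ 1` with `c² ≥ t` the Brownian motion `c⁻¹ B(c² ·)` (`IsBrownianReal.smul`)
drives the hulls `c⁻¹ Kₛ(c² ·)` (`Loewner.hull_scale_holds`), is again covered by Cor. 3.5 and by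
`IsGeneratedByCurve.scale`, and `t/c² ≤ 1` (`ae_volume_frontier_hull_eq_zero_of_cor35`); dilations
preserve null sets. [cite: RohdeSchramm2005, Cor 5.3] -/
theorem ae_volume_frontier_sleHull_eight_eq_zero_of_cor35
    (h35 : RohdeSchramm2005_cor35 Process.preWienerMeasure) (h8 : HasSLETrace 8) (t : ℝ≥0) :
    ∀ᵐ ω ∂Process.preWienerMeasure, volume (frontier (sleHull 8 ω t)) = 0 := by
  -- the scale `c = max t 1`, so that `t / c² ≤ 1`
  set c : ℝ≥0 := max t 1 with hc_def
  have hc1 : 1 ≤ c := le_max_right _ _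
  have hc0 : c ≠ 0 := (lt_of_lt_of_le one_pos hc1).ne'
  have hcc : c ^ 2 ≠ 0 := pow_ne_zero 2 hc0
  have htc : t / c ^ 2 ≤ 1 := by
    rw [div_le_iff₀ (pos_iff_ne_zero.2 hcc), one_mul, sq]
    exact (le_max_left t 1).trans (le_mul_of_one_le_right zero_le hc1)
  -- the rescaled Brownian motion and its driving function
  have hB := isBrownianReal_brownian'.smul hcc
  have hBc : ∀ ω : ℝ≥0 → ℝ, Continuous fun u ↦
      (Real.sqrt ((c ^ 2 : ℝ≥0) : ℝ))⁻¹ * Process.brownian (c ^ 2 * u) ω := fun ω ↦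
    continuous_const.mul ((Process.continuous_brownian ω).comp (continuous_const.mul continuous_id))
  have hsq : Real.sqrt ((c ^ 2 : ℝ≥0) : ℝ) = c := by
    push_cast
    exact Real.sqrt_sq c.2
  have hWeq : ∀ ω : ℝ≥0 → ℝ, (fun s ↦ Real.sqrt (8 : ℝ≥0) *
      ((Real.sqrt ((c ^ 2 : ℝ≥0) : ℝ))⁻¹ * Process.brownian (c ^ 2 * s) ω)) =
      fun s ↦ ((c⁻¹ : ℝ≥0) : ℝ) * sleDriving 8 ω (s / c⁻¹ ^ 2) := by
    intro ω
    funext s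
    rw [hsq, sleDriving_apply, inv_pow, div_inv_eq_mul, mul_comm s, NNReal.coe_inv]
    ring
  -- the rescaled chain is a.s. generated by a curve
  have hgen : ∀ᵐ ω ∂Process.preWienerMeasure, ∃ γ', Loewner.IsGeneratedByCurve
      (fun s ↦ Real.sqrt (8 : ℝ≥0) *
        ((Real.sqrt ((c ^ 2 : ℝ≥0) : ℝ))⁻¹ * Process.brownian (c ^ 2 * s) ω)) γ' := by
    filter_upwards [h8] with ω ⟨γ, hγ⟩
    rw [hWeq ω]
    exact ⟨_, hγ.scale (inv_ne_zero hc0)⟩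
  filter_upwards [ae_volume_frontier_hull_eq_zero_of_cor35 h35 hB hBc hgen htc] with ω hω
  -- `hull (c⁻¹ W(c² ·)) (t/c²) = c⁻¹ · Kₜ`
  rw [hWeq ω, Loewner.hull_scale_holds _ _ (inv_ne_zero hc0),
    show t / c ^ 2 / c⁻¹ ^ 2 = t by rw [inv_pow, div_div, mul_inv_cancel₀ hcc, div_one]] at hω
  change volume (frontier ((fun z : ℂ ↦ ((c⁻¹ : ℝ≥0) : ℂ) * z) '' sleHull 8 ω t)) = 0 at hω
  have hcne : (((c⁻¹ : ℝ≥0) : ℝ) : ℂ) ≠ 0 := by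
    rw [Ne, Complex.ofReal_eq_zero, NNReal.coe_eq_zero]
    exact inv_ne_zero hc0
  -- frontier commutes with the dilation, which scales the area by `c⁻²`
  set a : ℝ := ((c⁻¹ : ℝ≥0) : ℝ) with ha_def
  have ha : a ≠ 0 := NNReal.coe_ne_zero.2 (inv_ne_zero hc0)
  rw [← Homeomorph.coe_mulLeft₀ (a : ℂ) hcne, ← Homeomorph.image_frontier,
    Homeomorph.coe_mulLeft₀] at hω
  have himage : (fun z : ℂ ↦ (a : ℂ) * z) '' frontier (sleHull 8 ω t) = a • frontier (sleHull 8 ω t) := by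
    rw [← Set.image_smul]
    refine image_congr fun z _ ↦ ?_
    rw [Complex.real_smul]
  rw [himage, Measure.addHaar_smul, mul_eq_zero] at hω
  rcases hω with h0 | h0
  · exfalso
    rw [ENNReal.ofReal_eq_zero, Complex.finrank_real_complex] at h0
    have : (0 : ℝ) < |a ^ 2| := by positivity
    linarith
  · exact h0

/-- **`RohdeSchramm2005_thm71_eight` from `RohdeSchramm2005_cor35` alone.** Rohde–Schramm's
Thm. 7.1 at `κ = 8` (the Update, p. 911: if SLE₈ is generated by a curve — [LSW] Thm. 4.7 —
then a.s. `|γ(t)| → ∞`) follows from the derivative estimate Cor. 3.5: Cor. 3.5 ⇒ Cor. 5.3 at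
`κ = 8` (`ae_volume_frontier_sleHull_eight_eq_zero_of_cor35`, through the grid bound (5.4), Koebe
distortion and the porosity/density lemma) ⇒ Lemma 7.3 at `κ = 8` ⇒ Thm. 7.1
(`RohdeSchramm2005_thm71_eight_of_smallbd`). [cite: RohdeSchramm2005, Thm 7.1 and Update (p. 911)] -/
theorem RohdeSchramm2005_thm71_eight_of_cor35
    (h35 : RohdeSchramm2005_cor35 Process.preWienerMeasure) : RohdeSchramm2005_thm71_eight :=
  fun h8 ↦ tendsto_norm_sleTrace_atTop_of_frontier_null h8 le_rfl
    (ae_volume_frontier_sleHull_eight_eq_zero_of_cor35 h35 h8)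

end Cor53

end Literature.Probability.RandomPlanarGeometry

end
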